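/-
COR-CM (cell pub-hodgecm2, stage 2 of the Hodge ladder) — count-neutral KERNEL COMBINATORICS «β − 1 − δ_B faces for every Galois CM field of quartic-twist
type» (seat prover-pub-hodgecm2-b23-g41-0, binder prover b23, gen 41; claim QUARTIC-TRANSPORT F4, HOME/INBOX.md l.10098).
Theorems only; no geometry beyond the tree's `Face` / `faceOfG`, no `Universe` field touched, no named fact, nothing asserted; seat b09's law of the quartic
twist (`Census/QuarticTwist*`, through this seat's transport `Census/ClockTypes{Dictionary,Transport,Law}.lean`), seat b09's floors
(`CorCM/FaceParityFloor.lean`, `CorCM/FaceCoinvariantFloor.lean`), the INT2-GEN socket (`CorCM/FacePeriodsGeneratingSet.lean`) and the generic transfer `CorCM/FaceGenerationTransfer.lean`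
are used BY NAME; `Interfaces.lean` (C1), every E term, B01, `Transposition/*`, `PortJoin/*` are untouched.
HONEST FRAMING (COORDINATOR RULING — HODGE FRAMING CORRECTION, 2026-08-21T11:55:35Z): `HC_CM` is NOT proved, here or anywhere in the tree;
this file produces no period and proves no face period for any field; its `HodgeConjectureFor` statements are CONDITIONAL on face periods.
T5: n/a-class — the only Prop hypothesis binders displayed are the quartic datum equations (`θ (P * Q) = θ P + θ Q`, `θ conjT = (2, 0)` / the
`Aut`-datum equations), `3 ≤ |B|`, the order condition on `B`, and INT2-GEN's period hypothesis on the produced face set (§3); no named-fact /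
conjecture-def binder; checker: self (prover-pub-hodgecm2-b23-g41-0), 2026-08-23.
-/
import Summits.HodgeConjecture.CorCM.Census.ClockTypesLaw
import Summits.HodgeConjecture.CorCM.FaceGenerationTransfer
import Summits.HodgeConjecture.CorCM.FaceCensusOddSliceTransport
import HarnessLib

/-!
# Galois CM fields of quartic-twist type: EXACTLY `β − 1 − [∃ t ∈ B, 4 ∣ ord t]` generating rank-four faces

Let `F` be a Galois CM field whose Galois translates `GalT F` carry a QUARTIC DATUM: a bijection `θ : GalT F ≃ ZMod 4 × B`, multiplicative-to-
additive, with `θ conjT = (2, 0)` — i.e. `Gal(F/ℚ) = ⟨u⟩ × B` with `u` CENTRAL OF ORDER FOUR and `u² =` complex conjugation (`B` ANY finite group,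
`|B| ≥ 3`, `[F:ℚ] = 4|B| ≥ 12`).  These are the fields `F = k₄·L` with `k₄` a cyclic quartic CM field (`ℚ(ζ₅)`, `ℚ(√−(2+√2))`, …) and `L` a totally
real Galois field with group `B`, linearly disjoint from `k₄`; complex conjugation is a SQUARE in `Gal(F/ℚ)` (the TWISTED column of the census:
no imaginary quadratic subfield when `|B|` is odd), so none of `CorCM/FaceAbelian*`, `CorCM/FaceComplement*`, `CorCM/FaceCyclicGeneration` (unless
`B` is cyclic of odd order) applies.  Write `β(F) = #Block conjT` (↔ the simple CM isogeny classes split by `F`) and `δ_B = [∃ t ∈ B, 4 ∣ ord t]`.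

* §1 **`exists_faces_hgen_of_quartic`** / **`isLeast_card_faces_hgen_of_quartic`**: for every base embedding `σ₀` there is a finite set `𝒮` of rank-four
  faces of `F` with **`|𝒮| + 1 + δ_B = β(F)`** satisfying INT2-GEN's generation binder `hgen(𝒮, σ₀)`, and NO SMALLER face set does — the least size is
  EXACTLY `β(F) − 1 − δ_B` (**`β(F) − 2`** when `B` has an element of order divisible by `4`, **`β(F) − 1`** otherwise, in particular for `|B|` odd).
  This is seat b09's law of the quartic twist (`Census/QuarticTwistNoScrew.quarticTwist_complete_law`: Lee-potential squares, the three residual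
  faces, the screw saving and the half-parity functional) transported to `CMF (GalT F) conjT` (`Census/ClockTypesLaw.isLeast_card_gfaces_generate_of_quartic`)
  and carried to the field by the generic transfer `CorCM/FaceGenerationTransfer.lean` (`FaceTransfer.isLeast_card_faces_hgen_of_intrinsic`:
  `faceOfG` reads via `FaceCyclic.exists_faces_reading` / `span_translates_le_reads` / `hgen_of_weightRel_mem_span`, floor via `FaceParity.gfaceSet_subset_of_hgen`).
* §2 the datum from the automorphism group (`autDatum_quartic`: `ε : Aut(F) ≃ ZMod 4 × B`, `ε (gh) = ε g + ε h`, `ε (conj) = (2,0)` ⟹ a quartic datum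
  on `GalT F` through `galTOfAut σ₀`), and the degree `[F:ℚ] = 4|B|`.
* §3 **`hodgeConjectureFor_of_quartic_of_exists_facePeriod`** (INT2-GEN socket BY NAME): a face set of that least size EXISTS whose periods on the
  universe of record give the Hodge conjecture for every abelian variety dominated by a product of CM abelian varieties with CM by subfields of `F` —
  CONDITIONAL on those periods; `HC_CM` is NOT proved.

References: [cite: Pohlmann1968, Thm. 1]; [cite: Milne1999LefschetzClasses, Thm. 3.2, Prop. 2.1]; [cite: Shimura1998, §6.2 Theorem 3 and §6.1
Corollary of Theorem 2 (pp. 41–43), §8.1 (p. 62)]; [cite: MumfordAV1970, §19 Thm. 1 and p. 169].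
-/

noncomputable section

open CategoryTheory NumberField NumberField.ComplexEmbedding
open Literature.AlgebraicGeometry Literature.AlgebraicGeometry.Motives Literature.AlgebraicGeometry.HodgeTheory
open Literature.AlgebraicGeometry.ComplexMultiplication Literature.AlgebraicGeometry.Milne1999
open Literature.NumberTheory.Automorphic
open Literature.NumberTheory.Automorphic.PicardCM
open Summit.HodgeConjecture.CorCM.Domination

namespace Summit.HodgeConjecture.CorCM.FaceQuarticTwist

open Summit.HodgeConjecture.CorCM.Prior.AllgGroup.RfwfAllgGroup
open Summit.HodgeConjecture.CorCM.Census.BlockParity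
open Summit.HodgeConjecture.CorCM.Census.Coinvariant
open Summit.HodgeConjecture.CorCM.Census
open Summit.HodgeConjecture.CorCM.FaceCensus.OddSlice (galTOfAut galTOfAut_symm_mul galTOfAut_conjAut)

/-! ## §1 Quartic datum on the Galois translates: `β(F) − 1 − δ_B` generating faces, none fewer -/

section Field

variable {F : Type} [Field F] [NumberField F]
variable {B : Type} [AddGroup B] [Fintype B] [DecidableEq B]

/-- **The field-level floor**: for `F` Galois CM with a quartic datum over `B` (`|B| ≥ 3`), every face set `𝒮` with `hgen(𝒮, σ₀)` has
`β(F) ≤ |𝒮| + 1 + δ_B` (seat b09's floors through `ClockTypes.card_block_le_card_add_of_quartic` and `FaceTransfer.le_card_of_hgen_of_floor`). [folklore] -/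
theorem card_block_le_card_add_of_hgen [IsCMField F] [IsGalois ℚ F] (θ : GalT F ≃ ZMod 4 × B)
    (hθ : ∀ P Q : GalT F, θ (P * Q) = θ P + θ Q) (hθc : θ conjT = (2, 0)) (h3 : 3 ≤ Fintype.card B) (𝒮 : Finset (Face F)) (σ₀ : F →+* ℂ)
    (hgen : ∀ f : Face F, lefChar f.corner (fun _ => ({σ₀} : Finset (F →+* ℂ))) ∈ AddSubgroup.closure
      {a : Asym F | ∃ g ∈ (𝒮 : Set (Face F)), ∃ σ : F →+* ℂ, a = lefChar g.corner (fun _ => ({σ} : Finset (F →+* ℂ)))}) :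
    Fintype.card (Block (conjT : GalT F)) ≤ 𝒮.card + 1 + (if ∃ t : B, 4 ∣ addOrderOf t then 1 else 0) := by
  have h := FaceTransfer.le_card_of_hgen_of_floor
    (Fintype.card (Block (conjT : GalT F)) - 1 - (if ∃ t : B, 4 ∣ addOrderOf t then 1 else 0))
    (fun S₀ hS₀ hS => by have := ClockTypes.card_block_le_card_add_of_quartic θ hθ hθc conjT_mul_self h3 S₀ hS₀ hS; omega) 𝒮 σ₀ hgen
  have h2 := ClockTypes.exists_gfaces_generate_of_quartic θ hθ hθc conjT_mul_self h3
  obtain ⟨S, -, hS, -⟩ := h2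
  omega

/-- **EVERY GALOIS CM FIELD OF QUARTIC-TWIST TYPE HAS `β − 1 − δ_B` GENERATING FACES, AND NONE FEWER**: for `F` Galois CM with a quartic datum
`θ : GalT F ≃ ZMod 4 × B` (`θ (PQ) = θ P + θ Q`, `θ conjT = (2,0)`, `|B| ≥ 3`) and any base embedding `σ₀`, the least size of a face set `𝒮` with `hgen(𝒮, σ₀)` is
EXACTLY `β(F) − 1 − δ_B` (`FaceTransfer.isLeast_card_faces_hgen_of_intrinsic` on `ClockTypes.exists_gfaces_generate_of_quartic` /
`ClockTypes.card_block_le_card_add_of_quartic`). [folklore] -/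
theorem isLeast_card_faces_hgen_of_quartic [IsCMField F] [IsGalois ℚ F] (θ : GalT F ≃ ZMod 4 × B)
    (hθ : ∀ P Q : GalT F, θ (P * Q) = θ P + θ Q) (hθc : θ conjT = (2, 0)) (h3 : 3 ≤ Fintype.card B) (σ₀ : F →+* ℂ) :
    IsLeast {m : ℕ | ∃ 𝒮 : Finset (Face F), 𝒮.card = m ∧
      ∀ f : Face F, lefChar f.corner (fun _ => ({σ₀} : Finset (F →+* ℂ))) ∈ AddSubgroup.closure
        {a : Asym F | ∃ g ∈ (𝒮 : Set (Face F)), ∃ σ : F →+* ℂ, a = lefChar g.corner (fun _ => ({σ} : Finset (F →+* ℂ)))}}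
      (Fintype.card (Block (conjT : GalT F)) - 1 - (if ∃ t : B, 4 ∣ addOrderOf t then 1 else 0)) := by
  refine FaceTransfer.isLeast_card_faces_hgen_of_intrinsic _ ?_ (fun S₀ hS₀ hS => ?_) σ₀
  · obtain ⟨S, hS, hcard, hgen⟩ := ClockTypes.exists_gfaces_generate_of_quartic θ hθ hθc conjT_mul_self h3
    exact ⟨S, hS, by omega, hgen⟩
  · have := ClockTypes.card_block_le_card_add_of_quartic θ hθ hθc conjT_mul_self h3 S₀ hS₀ hS
    omega

/-- **Existence with the exact count**: a face set `𝒮` with `|𝒮| + 1 + δ_B = β(F)` and `hgen(𝒮, σ₀)`. [folklore] -/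
theorem exists_faces_hgen_of_quartic [IsCMField F] [IsGalois ℚ F] (θ : GalT F ≃ ZMod 4 × B)
    (hθ : ∀ P Q : GalT F, θ (P * Q) = θ P + θ Q) (hθc : θ conjT = (2, 0)) (h3 : 3 ≤ Fintype.card B) (σ₀ : F →+* ℂ) :
    ∃ 𝒮 : Finset (Face F), 𝒮.card + 1 + (if ∃ t : B, 4 ∣ addOrderOf t then 1 else 0) = Fintype.card (Block (conjT : GalT F)) ∧
      ∀ f : Face F, lefChar f.corner (fun _ => ({σ₀} : Finset (F →+* ℂ))) ∈ AddSubgroup.closure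
        {a : Asym F | ∃ g ∈ (𝒮 : Set (Face F)), ∃ σ : F →+* ℂ, a = lefChar g.corner (fun _ => ({σ} : Finset (F →+* ℂ)))} := by
  obtain ⟨⟨𝒮, hcard, hgen⟩, -⟩ := isLeast_card_faces_hgen_of_quartic θ hθ hθc h3 σ₀
  obtain ⟨S, -, hS, -⟩ := ClockTypes.exists_gfaces_generate_of_quartic θ hθ hθc conjT_mul_self h3
  exact ⟨𝒮, by omega, hgen⟩

/-- **`B` with an element of order divisible by four: EXACTLY `β(F) − 2` generating faces** (seat b09's screw case). [folklore] -/
theorem isLeast_card_faces_hgen_of_quartic_screw [IsCMField F] [IsGalois ℚ F] (θ : GalT F ≃ ZMod 4 × B)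
    (hθ : ∀ P Q : GalT F, θ (P * Q) = θ P + θ Q) (hθc : θ conjT = (2, 0)) (h3 : 3 ≤ Fintype.card B) {t : B} (h4 : 4 ∣ addOrderOf t)
    (σ₀ : F →+* ℂ) :
    IsLeast {m : ℕ | ∃ 𝒮 : Finset (Face F), 𝒮.card = m ∧
      ∀ f : Face F, lefChar f.corner (fun _ => ({σ₀} : Finset (F →+* ℂ))) ∈ AddSubgroup.closure
        {a : Asym F | ∃ g ∈ (𝒮 : Set (Face F)), ∃ σ : F →+* ℂ, a = lefChar g.corner (fun _ => ({σ} : Finset (F →+* ℂ)))}}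
      (Fintype.card (Block (conjT : GalT F)) - 2) := by
  have h := isLeast_card_faces_hgen_of_quartic θ hθ hθc h3 σ₀
  rwa [if_pos ⟨t, h4⟩] at h

/-- **No element of `B` of order divisible by four: EXACTLY `β(F) − 1` generating faces** (seat b09's half-parity floor). [folklore] -/
theorem isLeast_card_faces_hgen_of_quartic_noScrew [IsCMField F] [IsGalois ℚ F] (θ : GalT F ≃ ZMod 4 × B)
    (hθ : ∀ P Q : GalT F, θ (P * Q) = θ P + θ Q) (hθc : θ conjT = (2, 0)) (h3 : 3 ≤ Fintype.card B) (h4 : ∀ t : B, ¬ 4 ∣ addOrderOf t)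
    (σ₀ : F →+* ℂ) :
    IsLeast {m : ℕ | ∃ 𝒮 : Finset (Face F), 𝒮.card = m ∧
      ∀ f : Face F, lefChar f.corner (fun _ => ({σ₀} : Finset (F →+* ℂ))) ∈ AddSubgroup.closure
        {a : Asym F | ∃ g ∈ (𝒮 : Set (Face F)), ∃ σ : F →+* ℂ, a = lefChar g.corner (fun _ => ({σ} : Finset (F →+* ℂ)))}}
      (Fintype.card (Block (conjT : GalT F)) - 1) := by
  have h := isLeast_card_faces_hgen_of_quartic θ hθ hθc h3 σ₀
  rwa [if_neg (fun ⟨t, ht⟩ => h4 t ht), Nat.sub_zero] at h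

/-- **`|B|` odd** (`F = k₄·L` with `[L:ℚ]` odd — no imaginary quadratic subfield at all): **EXACTLY `β(F) − 1` generating faces.** [folklore] -/
theorem isLeast_card_faces_hgen_of_quartic_odd [IsCMField F] [IsGalois ℚ F] (θ : GalT F ≃ ZMod 4 × B)
    (hθ : ∀ P Q : GalT F, θ (P * Q) = θ P + θ Q) (hθc : θ conjT = (2, 0)) (h3 : 3 ≤ Fintype.card B) (hodd : Odd (Fintype.card B))
    (σ₀ : F →+* ℂ) :
    IsLeast {m : ℕ | ∃ 𝒮 : Finset (Face F), 𝒮.card = m ∧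
      ∀ f : Face F, lefChar f.corner (fun _ => ({σ₀} : Finset (F →+* ℂ))) ∈ AddSubgroup.closure
        {a : Asym F | ∃ g ∈ (𝒮 : Set (Face F)), ∃ σ : F →+* ℂ, a = lefChar g.corner (fun _ => ({σ} : Finset (F →+* ℂ)))}}
      (Fintype.card (Block (conjT : GalT F)) - 1) :=
  isLeast_card_faces_hgen_of_quartic_noScrew θ hθ hθc h3 (ClockTypes.not_four_dvd_addOrderOf_of_odd hodd) σ₀

/-- **Screw case: the least size is seat b09's coinvariant fibre `φ₂(F) = β(F) − 2`.** [folklore] -/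
theorem fibreTwo_add_two_eq_card_block_of_quartic_screw [IsCMField F] [IsGalois ℚ F] (θ : GalT F ≃ ZMod 4 × B)
    (hθ : ∀ P Q : GalT F, θ (P * Q) = θ P + θ Q) (hθc : θ conjT = (2, 0)) (h3 : 3 ≤ Fintype.card B) {t : B} (h4 : 4 ∣ addOrderOf t) :
    fibreTwo (conjT : GalT F) conjT_mul_self + 2 = Fintype.card (Block (conjT : GalT F)) :=
  ClockTypes.fibreTwo_add_two_eq_card_block_of_screw θ hθ hθc conjT_mul_self h3 h4

/-! ## §2 The datum from the automorphism group; the degree -/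

omit [Fintype B] [DecidableEq B] in
/-- **The quartic datum from an `Aut`-datum.**  A bijection `ε : Aut(F) ≃ ℤ/4 × B`, multiplicative-to-additive and carrying the complex conjugation at
`σ₀` to `(2, 0)`, gives the quartic datum `θ = ε ∘ (galTOfAut σ₀)⁻¹` on `GalT F`. [folklore] -/
theorem autDatum_quartic [IsGalois ℚ F] (σ₀ : F →+* ℂ) (ε : (F ≃ₐ[ℚ] F) ≃ ZMod 4 × B)
    (hε : ∀ g h : F ≃ₐ[ℚ] F, ε (g * h) = ε g + ε h) {c : F ≃ₐ[ℚ] F} (hcσ : σ₀.comp (c : F →+* F) = conjugate σ₀) (hεc : ε c = (2, 0)) :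
    (∀ P Q : GalT F, ((galTOfAut σ₀).symm.trans ε) (P * Q) = ((galTOfAut σ₀).symm.trans ε) P + ((galTOfAut σ₀).symm.trans ε) Q) ∧
      ((galTOfAut σ₀).symm.trans ε) conjT = (2, 0) := by
  refine ⟨fun P Q => ?_, ?_⟩
  · simp only [Equiv.trans_apply, galTOfAut_symm_mul, hε]
  · rw [Equiv.trans_apply, ← galTOfAut_conjAut σ₀ hcσ, Equiv.symm_apply_apply, hεc]

/-- **`Aut`-datum form of the law**: EXACTLY `β(F) − 1 − δ_B` generating faces. [folklore] -/
theorem isLeast_card_faces_hgen_of_quartic_aut [IsCMField F] [IsGalois ℚ F] (σ₀ : F →+* ℂ) (ε : (F ≃ₐ[ℚ] F) ≃ ZMod 4 × B)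
    (hε : ∀ g h : F ≃ₐ[ℚ] F, ε (g * h) = ε g + ε h) {c : F ≃ₐ[ℚ] F} (hcσ : σ₀.comp (c : F →+* F) = conjugate σ₀) (hεc : ε c = (2, 0))
    (h3 : 3 ≤ Fintype.card B) :
    IsLeast {m : ℕ | ∃ 𝒮 : Finset (Face F), 𝒮.card = m ∧
      ∀ f : Face F, lefChar f.corner (fun _ => ({σ₀} : Finset (F →+* ℂ))) ∈ AddSubgroup.closure
        {a : Asym F | ∃ g ∈ (𝒮 : Set (Face F)), ∃ σ : F →+* ℂ, a = lefChar g.corner (fun _ => ({σ} : Finset (F →+* ℂ)))}}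
      (Fintype.card (Block (conjT : GalT F)) - 1 - (if ∃ t : B, 4 ∣ addOrderOf t then 1 else 0)) := by
  obtain ⟨hθ, hθc⟩ := autDatum_quartic σ₀ ε hε hcσ hεc
  exact isLeast_card_faces_hgen_of_quartic ((galTOfAut σ₀).symm.trans ε) hθ hθc h3 σ₀

omit [AddGroup B] [DecidableEq B] in
/-- **The degree of a quartic-twist field is `4|B|`.** [folklore] -/
theorem finrank_eq_four_mul_card [IsGalois ℚ F] (θ : GalT F ≃ ZMod 4 × B) : Module.finrank ℚ F = 4 * Fintype.card B := by
  rw [← FaceCensus.card_galT, Fintype.card_congr θ, Fintype.card_prod, ZMod.card]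

omit [AddGroup B] [DecidableEq B] in
/-- A quartic-twist field over `B` with `|B| ≥ 3` has degree at least `12`. [folklore] -/
theorem twelve_le_finrank [IsGalois ℚ F] (θ : GalT F ≃ ZMod 4 × B) (h3 : 3 ≤ Fintype.card B) : 12 ≤ Module.finrank ℚ F := by
  rw [finrank_eq_four_mul_card θ]
  omega

end Field

/-! ## §3 The Hodge-conjecture reading through the INT2-GEN socket (conditional on the face periods) -/

variable {B : Type} [AddGroup B] [Fintype B] [DecidableEq B]

/-- **HC for the slice of a Galois CM field of quartic-twist type from `β − 1 − δ_B` face periods** (INT2-GEN socket BY NAME; CONDITIONAL on the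
periods — `HC_CM` is NOT proved): for `K` Galois CM with a quartic datum `θ : GalT K ≃ ZMod 4 × B` (`|B| ≥ 3`) there is a face set `𝒮` with
`|𝒮| + 1 + δ_B = β(K)` such that, if every face of `𝒮` has a non-vanishing period on the universe of record, the Hodge conjecture holds for every
abelian variety dominated by a product of CM abelian varieties with CM by subfields of `K`.
[cite: Shimura1998, §6.2 Theorem 3 and §6.1 Corollary of Theorem 2 (pp. 41–43)] [cite: Pohlmann1968, Thm. 1]
[cite: Milne1999LefschetzClasses, Thm. 3.2 and Cor. 4.5] [cite: MumfordAV1970, §19 Thm. 1 and p. 169] -/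
theorem hodgeConjectureFor_of_quartic_of_exists_facePeriod (K : CMField) [hGal : IsGalois ℚ K] (θ : GalT K ≃ ZMod 4 × B)
    (hθ : ∀ P Q : GalT K, θ (P * Q) = θ P + θ Q) (hθc : θ conjT = (2, 0)) (h3 : 3 ≤ Fintype.card B) (σ₀ : (K : Type) →+* ℂ) :
    ∃ 𝒮 : Finset (Face K), 𝒮.card + 1 + (if ∃ t : B, 4 ∣ addOrderOf t then 1 else 0) = Fintype.card (Block (conjT : GalT K)) ∧
      ((∀ f ∈ 𝒮, ∃ ι₁ : K →+* ℂ, f.Admissible ι₁ ∧ ∃ (V : HermSpace3 K ι₁) (σ : K →+* ℂ),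
        (Model.picardCMUniverse exists_isReal_hodgeModel_holds hodgePQ_independent_of_hodgeModel_holds
          BallQuotient.ballQuotientUniformised_holds cmAbelianVarietyRealised_holds).PeriodNV ι₁ V K f.psi σ) →
      ∀ {P A : AbelianVariety ℂ}, AbelianVariety.IsProductOf (fun A : AbelianVariety ℂ =>
        ∃ (E : Type) (_ : Field E) (_ : NumberField E) (_ : IsCMField E) (_ : E →+* (K : Type)) (Φ : CMType E)
          (ι : 𝓞 E →+* End A) (ϑ : E →+* Module.End ℂ (complexBetti A.X 1)),
          IsCMTypeRealisation Φ A ι ϑ) P →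
      AVDominatedBy A P → HodgeConjectureFor A.dim A.X) := by
  obtain ⟨𝒮, hcard, hgen⟩ := exists_faces_hgen_of_quartic (F := K) θ hθ hθc h3 σ₀
  refine ⟨𝒮, hcard, fun h P A hP hA => ?_⟩
  exact hodgeConjectureFor_of_avDominatedBy_isProductOf_of_exists_facePeriod_on K
    ((twelve_le_finrank (F := K) θ h3).trans' (by norm_num)) (𝒮 : Set (Face K)) σ₀ hgen (fun f hf => h f (Finset.mem_coe.mp hf)) hP hA

/-- **`Aut`-datum form of the HC reading** (CONDITIONAL — `HC_CM` is NOT proved). [cite: Shimura1998, §6.2 Theorem 3 and §6.1 Corollary of Theorem 2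
(pp. 41–43)] [cite: Pohlmann1968, Thm. 1] [cite: Milne1999LefschetzClasses, Thm. 3.2 and Cor. 4.5] [cite: MumfordAV1970, §19 Thm. 1 and p. 169] -/
theorem hodgeConjectureFor_of_quartic_aut_of_exists_facePeriod (K : CMField) [hGal : IsGalois ℚ K] (σ₀ : (K : Type) →+* ℂ)
    (ε : ((K : Type) ≃ₐ[ℚ] (K : Type)) ≃ ZMod 4 × B) (hε : ∀ g h : (K : Type) ≃ₐ[ℚ] (K : Type), ε (g * h) = ε g + ε h)
    {c : (K : Type) ≃ₐ[ℚ] (K : Type)} (hcσ : σ₀.comp (c : (K : Type) →+* (K : Type)) = conjugate σ₀) (hεc : ε c = (2, 0))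
    (h3 : 3 ≤ Fintype.card B) :
    ∃ 𝒮 : Finset (Face K), 𝒮.card + 1 + (if ∃ t : B, 4 ∣ addOrderOf t then 1 else 0) = Fintype.card (Block (conjT : GalT K)) ∧
      ((∀ f ∈ 𝒮, ∃ ι₁ : K →+* ℂ, f.Admissible ι₁ ∧ ∃ (V : HermSpace3 K ι₁) (σ : K →+* ℂ),
        (Model.picardCMUniverse exists_isReal_hodgeModel_holds hodgePQ_independent_of_hodgeModel_holds
          BallQuotient.ballQuotientUniformised_holds cmAbelianVarietyRealised_holds).PeriodNV ι₁ V K f.psi σ) →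
      ∀ {P A : AbelianVariety ℂ}, AbelianVariety.IsProductOf (fun A : AbelianVariety ℂ =>
        ∃ (E : Type) (_ : Field E) (_ : NumberField E) (_ : IsCMField E) (_ : E →+* (K : Type)) (Φ : CMType E)
          (ι : 𝓞 E →+* End A) (ϑ : E →+* Module.End ℂ (complexBetti A.X 1)),
          IsCMTypeRealisation Φ A ι ϑ) P →
      AVDominatedBy A P → HodgeConjectureFor A.dim A.X) := by
  obtain ⟨hθ, hθc⟩ := autDatum_quartic (F := K) σ₀ ε hε hcσ hεc
  exact hodgeConjectureFor_of_quartic_of_exists_facePeriod K ((galTOfAut σ₀).symm.trans ε) hθ hθc h3 σ₀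

end Summit.HodgeConjecture.CorCM.FaceQuarticTwist

end
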